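import Mathlib
import Summits.CriticalPhenomena.CardyFormulaZ2.Theorems.CardyMagicRigidityPositiveConeJointDefs
import Summits.CriticalPhenomena.CardyFormulaZ2.Theorems.CardyMagicRigidityNestingRigidityTransferSimpleLoops
import Literature.Probability.RandomPlanarGeometry.LoopWinding
import HarnessLib

/-!
# `tame_rigidity`: the simple-loop case holds

Crux `Summit.CriticalPhenomena.CardyFormulaZ2.Theses.CardyMagicRigidity.NestingRigidity`
(stmt-CriticalPhenomena-4835), line `positive-cone-weight-doubling`.  The registered helper `tame_rigidity`
(a tame unbased loop is determined by its winding function) is FALSE in general (`not_tame_rigidity`,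
`…TameRigidityWitness` p132831: two-mouth lakes, i.e. pairs of double points with crossing chords).  This
small file records the positive part that survives and that a repaired support class may use: for tame loops
admitting a SIMPLE based representative (injective on `[0,1)`; no double point at all) the winding function
does determine the loop — `tame_rigidity_of_injOn` (anchor).  Proof: equal winding functions give equal winding
interiors, hence (`Tame.boundary`) equal traces, so `udist = 0` by the simple-loop reconstruction
`simpleLoop_udist_eq_zero_of_range_eq` (p125567), i.e. `v = u` or `v = u.reverse`; the reversal is excluded
by the sign of `W` (`W(u.reverse) = −W(u)` and a tame loop winds around some point: its interior has nonempty
frontier, the trace).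
-/

noncomputable section

open Set Metric

namespace Summit.CriticalPhenomena.CardyFormulaZ2.Cruxes.NestingRigidity.PositiveConeWeightDoubling

open Literature.Probability.RandomPlanarGeometry
open Summit.CriticalPhenomena.CardyFormulaZ2.Cruxes.NestingRigidity.RingCloudTomography
  (simpleLoop_udist_eq_zero_of_range_eq)

/-- A tame loop winds around some point. -/
theorem Tame.exists_wind_ne_zero {u : UnbasedLoop ℂ} (hu : Tame u) : ∃ z, u.wind z ≠ 0 := by
  by_contra h
  push Not at h
  have he : {z | u.wind z ≠ 0} = ∅ := eq_empty_of_forall_notMem fun z hz ↦ hz (h z)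
  have := hu.boundary
  rw [he, frontier_empty] at this
  exact (UnbasedLoop.range_nonempty u).ne_empty this

/-- A tame loop is not its own reversal up to the winding function: `W(u.reverse) = W(u)` everywhere is
impossible. -/
theorem Tame.ne_reverse_of_wind_eq {u v : UnbasedLoop ℂ} (hu : Tame u) (h : ∀ z, u.wind z = v.wind z) :
    v ≠ u.reverse := by
  rintro rfl
  obtain ⟨z, hz⟩ := hu.exists_wind_ne_zero
  have := h z
  rw [UnbasedLoop.wind_reverse] at this
  rcases hu.signedDegreeOne with hs | hs <;> rcases hs z with h0 | h1
  · exact hz h0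
  · rw [h1] at this; norm_num at this
  · exact hz h0
  · rw [h1] at this; norm_num at this

/-- **Anchor (registered): `tame_rigidity` holds for loops with a simple representative.**  Two tame unbased
loops of the plane with the same winding function, each admitting a based representative injective on
`[0, 1)`, are equal. -/
theorem tame_rigidity_of_injOn : ∀ u v : UnbasedLoop ℂ, Tame u → Tame v →
    (∃ (γ : Curve ℂ) (hγ : γ.IsLoop), InjOn γ (Iio 1) ∧ UnbasedLoop.mk (BasedLoop.mk (CurveClass.mk γ) hγ) = u) →
    (∃ (γ : Curve ℂ) (hγ : γ.IsLoop), InjOn γ (Iio 1) ∧ UnbasedLoop.mk (BasedLoop.mk (CurveClass.mk γ) hγ) = v) →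
    (∀ z, u.wind z = v.wind z) → u = v := by
  intro u v hu hv hsu hsv h
  have hint : {z | u.wind z ≠ 0} = {z | v.wind z ≠ 0} := by ext z; rw [mem_setOf_eq, mem_setOf_eq, h]
  have hrange : u.range = v.range := by rw [hu.boundary, hv.boundary, hint]
  have hud : u.udist v = 0 := simpleLoop_udist_eq_zero_of_range_eq u v hsu hsv hrange
  rcases UnbasedLoop.udist_eq_zero_iff.1 hud with huv | huv
  · exact huv.symm
  · exact absurd huv (hu.ne_reverse_of_wind_eq h)

end Summit.CriticalPhenomena.CardyFormulaZ2.Cruxes.NestingRigidity.PositiveConeWeightDoubling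

end
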